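import Summits.Ventures.CertifiedManyBodySolver.Observables.PairLROTowerCharged
import Literature.MathematicalPhysics.QuantumLattice.TranslationSumCommutatorLocality
import Literature.MathematicalPhysics.QuantumLattice.InfVolFermionStateDensity
import HarnessLib

/-!
# OP1-C, part 5: the `N̂` double-commutator input for ANY even word (mixed charges allowed)

HONEST FRAMING: first certified bounds on pairing observables; not a superconductivity verdict; a ceiling route,
never presence. Crew hubbard-obs (D-0042), seat hubbard-obs-p1 (`prover-hubbard-obs-p1-g8-0`). Zero compute; no
definition; no named fact; no `sorry`.

The hypotheses `hDDN₁/₂` of `liminf_pairFieldLRO_le_sq_of_onePoint_chargedStationary_bound_TT'` (and of the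
grid form `…_near`) ask for `|Re⟨χ,[B_j,[B_j,N̂]]χ⟩| ≤ D_N·L²` for the translation sums `B_j` of the two Hermitian
parts of the eom word. PairLROTowerChargedWords discharged them for a word of DEFINITE charge. Here they are
discharged for EVERY even local word — in particular for the multiplier-weighted COMBINATION `w = Σ_i ν_i w_i` of
charged rows of DIFFERENT charges (pair words `q = 2` together with bipair words `q = 4`, the common-μ programme
of sr-mbsolver-menu-3 MENU3-TLPINCER §7.3): the particle number is itself a translation sum,
`N̂ = Σ_v T_v Γ_L(n_{0↑} + n_{0↓})` (`totalNumber_eq_sum_translate_localNumber`), so `[B, N̂]` is the translation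
sum of a LOCAL density (`commutator_sum_relabel_translate`) and `[B,[B,N̂]]` is the commutator of two translation
sums of local words, `O(L²)` by TranslationSumCommutatorLocality
(`exists_abs_re_doubleCommutator_totalNumber_le`; both Hermitian parts at once:
`exists_abs_re_doubleCommutator_totalNumber_le_hermitianParts`).

References: O. Bratteli, D. W. Robinson, *Operator Algebras and Quantum Statistical Mechanics 2* (1997) §6.2.1
[BratteliRobinsonII1997]; T. Koma, H. Tasaki, J. Stat. Phys. 76 (1994) 745, §2 [KomaTasaki1994].
-/

noncomputable section

namespace Summit.Ventures.CertifiedManyBodySolver.Observables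

open Matrix Complex Finset Literature.MathematicalPhysics.QuantumLattice Literature.Probability.LatticeModels
open Literature.MathematicalPhysics.QuantumLattice.HubbardWave0 ThermodynamicLimit Filter Topology
open scoped ComplexOrder ComplexConjugate BigOperators

section NumberTranslationSum

variable {L : ℕ} [NeZero L]

/-- **The particle number of the torus is the translation sum of the local density**:
`N̂ = Σ_v T_v Γ_L(n_{0↑} + n_{0↓})`, the local word living on the one-point window `{0}`.
[cite: BratteliRobinsonII1997, §6.2.1] -/
theorem totalNumber_eq_sum_translate_localNumber (h : Set.InjOn (Torus.proj (d := 2) L) ↑({0} : Finset (Site 2))) :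
    (totalNumber : Matrix (Finset (Orb (FermionTorus 2 L))) (Finset (Orb (FermionTorus 2 L))) ℂ) =
      ∑ v : TorusSite 2 L, relabel (Orb.translate v) (fermionEmbed (PolySite.toTorusEmb L h)
        (nAt 0 (Finset.mem_singleton_self 0) 0 + nAt 0 (Finset.mem_singleton_self 0) 1)) := by
  have hproj : Torus.proj L (0 : Site 2) = 0 := by funext i; simp [Torus.proj]
  have hn : ∀ σ : Fin 2, fermionEmbed (PolySite.toTorusEmb L h) (nAt 0 (Finset.mem_singleton_self 0) σ) =
      numberOp (FermionTorus.ofTorusSite (0 : TorusSite 2 L)) σ := by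
    intro σ
    rw [nAt, fermionEmbed_numberOp, PolySite.toTorusEmb_apply, PolySite.ofLex_coe_pt, hproj]
  simp_rw [fermionEmbed_add, hn 0, hn 1, relabel_add, relabel_translate_numberOp, zero_add]
  rw [totalNumber]
  refine Fintype.sum_equiv FermionTorus.equivTorusSite _ _ fun x => ?_
  rw [Fin.sum_univ_two]
  simp [FermionTorus.equivTorusSite, FermionTorus.ofTorusSite_toTorusSite]

end NumberTranslationSum

section DoubleCommutator

variable {Λb : Finset (Site 2)}

/-- **`[B,[B,N̂]]` is `O(L²)` for the translation sum `B` of ANY even local word `b`.** There are `D ≥ 0`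
and `L₀` such that for every side `L ≥ L₀` on which `Λ_b` embeds and every unit `χ`,
`|Re⟨χ,(B(BN̂ − N̂B) − (BN̂ − N̂B)B)χ⟩| ≤ D·L²`, `B = Σ_v T_v Γ_L(b)`: `N̂` is the translation sum of the local
density, `[B, N̂]` the translation sum of a local word, and the commutator of two translation sums of local
words is `O(L²)`. [cite: BratteliRobinsonII1997, §6.2.1] -/
theorem exists_abs_re_doubleCommutator_totalNumber_le {b : FermionOp Λb}
    (hbeven : b ∈ carEvenSubalgebra (Finset.univ : Finset (Orb (PolySite Λb)))) :
    ∃ D : ℝ, ∃ L₀ : ℕ, 0 ≤ D ∧ ∀ (L : ℕ) [NeZero L], L₀ ≤ L →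
      ∀ (h : Set.InjOn (Torus.proj (d := 2) L) ↑Λb) (χ : Fock (Orb (FermionTorus 2 L))), star χ ⬝ᵥ χ = 1 →
      |(star χ ⬝ᵥ (((∑ v : TorusSite 2 L, relabel (Orb.translate v) (fermionEmbed (PolySite.toTorusEmb L h) b)) *
        ((∑ v : TorusSite 2 L, relabel (Orb.translate v) (fermionEmbed (PolySite.toTorusEmb L h) b)) * totalNumber -
          totalNumber * (∑ v : TorusSite 2 L, relabel (Orb.translate v) (fermionEmbed (PolySite.toTorusEmb L h) b))) -
        ((∑ v : TorusSite 2 L, relabel (Orb.translate v) (fermionEmbed (PolySite.toTorusEmb L h) b)) * totalNumber -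
          totalNumber * (∑ v : TorusSite 2 L, relabel (Orb.translate v) (fermionEmbed (PolySite.toTorusEmb L h) b))) *
        (∑ v : TorusSite 2 L, relabel (Orb.translate v) (fermionEmbed (PolySite.toTorusEmb L h) b))) *ᵥ χ)).re| ≤
        D * (L : ℝ) ^ 2 := by
  -- regions for the inner commutator `[B, N̂]`
  set Λ₀ : Finset (Site 2) := {0} with hΛ₀
  set nloc : FermionOp Λ₀ := nAt 0 (Finset.mem_singleton_self 0) 0 + nAt 0 (Finset.mem_singleton_self 0) 1
    with hnloc
  set Z : Finset (Site 2) := (Λ₀ ×ˢ Λb).image (fun p => p.1 - p.2) with hZ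
  set Ω : Finset (Site 2) := (Λb ∪ Λ₀) ∪ Z.biUnion (fun z => shiftSet z Λb) with hΩ
  have hbΩ : Λb ⊆ Ω := Finset.subset_union_left.trans Finset.subset_union_left
  have h0Ω : Λ₀ ⊆ Ω := Finset.subset_union_right.trans Finset.subset_union_left
  have hZΩ : ∀ z ∈ Z, shiftSet z Λb ⊆ Ω := fun z hz =>
    (Finset.subset_biUnion_of_mem (fun z => shiftSet z Λb) hz).trans Finset.subset_union_right
  have hcomplete : ∀ a ∈ Λb, ∀ c ∈ Λ₀, c - a ∈ Z := fun a ha c hc =>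
    Finset.mem_image.2 ⟨(c, a), Finset.mem_product.2 ⟨hc, ha⟩, rfl⟩
  set cD : FermionOp Ω := commDensity Ω Z h0Ω b nloc with hcD
  -- the outer commutator bound and the thresholds
  obtain ⟨C', L₂, hC', hcomm'⟩ := exists_abs_re_expect_commutator_sum_translate_le (d := 2) hbeven cD
  obtain ⟨L₁, hL₁⟩ := exists_forall_le_injOn_proj Ω
  obtain ⟨L₃, hL₃⟩ := exists_forall_le_injOn_proj Z
  refine ⟨C', max L₁ (max L₂ L₃), hC', fun L _ hL h χ hχ => ?_⟩
  have hΩinj : Set.InjOn (Torus.proj (d := 2) L) ↑Ω := hL₁ L (le_trans (le_max_left _ _) hL)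
  have hL₂L : L₂ ≤ L := le_trans (le_trans (le_max_left _ _) (le_max_right _ _)) hL
  have hZinj : Set.InjOn (Torus.proj (d := 2) L) ↑Z := hL₃ L (le_trans (le_trans (le_max_right _ _) (le_max_right _ _)) hL)
  -- `[B, N̂]` is the translation sum of the local word `cD`
  have key := commutator_sum_relabel_translate L hΩinj hZinj hbΩ h0Ω hZΩ hcomplete hbeven nloc
  rw [← totalNumber_eq_sum_translate_localNumber] at key
  have key' : (∑ v : TorusSite 2 L, relabel (Orb.translate v) (fermionEmbed (PolySite.toTorusEmb L h) b)) *
      totalNumber - totalNumber *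
      (∑ v : TorusSite 2 L, relabel (Orb.translate v) (fermionEmbed (PolySite.toTorusEmb L h) b)) =
      ∑ w : TorusSite 2 L, relabel (Orb.translate w) (fermionEmbed (PolySite.toTorusEmb L hΩinj) cD) := key
  rw [key']
  exact hcomm' L hL₂L h hΩinj χ hχ

/-- **Both `N̂` double-commutator inputs of OP1-C, for any word with even `w`, `wᴴ`.** The hypotheses
`hDDN₁`, `hDDN₂` of `liminf_pairFieldLRO_le_sq_of_onePoint_chargedStationary_bound_TT'[_near]` hold with a
common constant for `B₁ = Σ_v T_v Γ_L(½(w + wᴴ))` and `B₂ = Σ_v T_v Γ_L((i/2)(wᴴ − w))` — no charge structure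
needed, so multiplier-weighted sums of charged rows of different charges are covered.
[cite: BratteliRobinsonII1997, §6.2.1] [cite: KomaTasaki1994, §2] -/
theorem exists_abs_re_doubleCommutator_totalNumber_le_hermitianParts (wloc : FermionOp Λb)
    (hweven : wloc ∈ carEvenSubalgebra (Finset.univ : Finset (Orb (PolySite Λb))))
    (hwevenH : wlocᴴ ∈ carEvenSubalgebra (Finset.univ : Finset (Orb (PolySite Λb)))) :
    ∃ DN : ℝ, ∃ LN : ℕ, 0 ≤ DN ∧
      (∀ (L : ℕ) [NeZero L], LN ≤ L →
        ∀ (h : Set.InjOn (Torus.proj (d := 2) L) ↑Λb) (χ : Fock (Orb (FermionTorus 2 L))), star χ ⬝ᵥ χ = 1 →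
        |(star χ ⬝ᵥ (((∑ v : TorusSite 2 L, relabel (Orb.translate v)
            (fermionEmbed (PolySite.toTorusEmb L h) (((1 / 2 : ℂ)) • (wloc + wlocᴴ)))) *
          ((∑ v : TorusSite 2 L, relabel (Orb.translate v)
            (fermionEmbed (PolySite.toTorusEmb L h) (((1 / 2 : ℂ)) • (wloc + wlocᴴ)))) * totalNumber -
            totalNumber * (∑ v : TorusSite 2 L, relabel (Orb.translate v)
            (fermionEmbed (PolySite.toTorusEmb L h) (((1 / 2 : ℂ)) • (wloc + wlocᴴ))))) -
          ((∑ v : TorusSite 2 L, relabel (Orb.translate v)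
            (fermionEmbed (PolySite.toTorusEmb L h) (((1 / 2 : ℂ)) • (wloc + wlocᴴ)))) * totalNumber -
            totalNumber * (∑ v : TorusSite 2 L, relabel (Orb.translate v)
            (fermionEmbed (PolySite.toTorusEmb L h) (((1 / 2 : ℂ)) • (wloc + wlocᴴ))))) *
          (∑ v : TorusSite 2 L, relabel (Orb.translate v)
            (fermionEmbed (PolySite.toTorusEmb L h) (((1 / 2 : ℂ)) • (wloc + wlocᴴ))))) *ᵥ χ)).re| ≤
          DN * (L : ℝ) ^ 2) ∧
      (∀ (L : ℕ) [NeZero L], LN ≤ L →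
        ∀ (h : Set.InjOn (Torus.proj (d := 2) L) ↑Λb) (χ : Fock (Orb (FermionTorus 2 L))), star χ ⬝ᵥ χ = 1 →
        |(star χ ⬝ᵥ (((∑ v : TorusSite 2 L, relabel (Orb.translate v)
            (fermionEmbed (PolySite.toTorusEmb L h) ((I / 2 : ℂ) • (wlocᴴ - wloc)))) *
          ((∑ v : TorusSite 2 L, relabel (Orb.translate v)
            (fermionEmbed (PolySite.toTorusEmb L h) ((I / 2 : ℂ) • (wlocᴴ - wloc)))) * totalNumber -
            totalNumber * (∑ v : TorusSite 2 L, relabel (Orb.translate v)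
            (fermionEmbed (PolySite.toTorusEmb L h) ((I / 2 : ℂ) • (wlocᴴ - wloc))))) -
          ((∑ v : TorusSite 2 L, relabel (Orb.translate v)
            (fermionEmbed (PolySite.toTorusEmb L h) ((I / 2 : ℂ) • (wlocᴴ - wloc)))) * totalNumber -
            totalNumber * (∑ v : TorusSite 2 L, relabel (Orb.translate v)
            (fermionEmbed (PolySite.toTorusEmb L h) ((I / 2 : ℂ) • (wlocᴴ - wloc))))) *
          (∑ v : TorusSite 2 L, relabel (Orb.translate v)
            (fermionEmbed (PolySite.toTorusEmb L h) ((I / 2 : ℂ) • (wlocᴴ - wloc))))) *ᵥ χ)).re| ≤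
          DN * (L : ℝ) ^ 2) := by
  have hO₁even : ((1 / 2 : ℂ) • (wloc + wlocᴴ)) ∈ carEvenSubalgebra (Finset.univ : Finset (Orb (PolySite Λb))) :=
    Subalgebra.smul_mem _ (Subalgebra.add_mem _ hweven hwevenH) _
  have hO₂even : ((I / 2 : ℂ) • (wlocᴴ - wloc)) ∈ carEvenSubalgebra (Finset.univ : Finset (Orb (PolySite Λb))) :=
    Subalgebra.smul_mem _ (Subalgebra.sub_mem _ hwevenH hweven) _
  obtain ⟨D₁, L₁, hD₁, h₁⟩ := exists_abs_re_doubleCommutator_totalNumber_le hO₁even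
  obtain ⟨D₂, L₂, hD₂, h₂⟩ := exists_abs_re_doubleCommutator_totalNumber_le hO₂even
  refine ⟨max D₁ D₂, max L₁ L₂, le_max_of_le_left hD₁, fun L _ hL h χ hχ => ?_, fun L _ hL h χ hχ => ?_⟩
  · exact (h₁ L (le_trans (le_max_left _ _) hL) h χ hχ).trans
      (mul_le_mul_of_nonneg_right (le_max_left _ _) (by positivity))
  · exact (h₂ L (le_trans (le_max_right _ _) hL) h χ hχ).trans
      (mul_le_mul_of_nonneg_right (le_max_right _ _) (by positivity))

end DoubleCommutator

section ChargeOnePoint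

variable {L : ℕ} [NeZero L] {Λb : Finset (Site 2)}

/-- **The one-point size of the charge of `W_L`, for ANY local word** (the input `hWq` of the grid theorem
`…_near`, no charge decomposition needed): `N̂W_L − W_LN̂` is the translation sum of the LOCAL word
`N̂₀w − wN̂₀` (`totalNumberOp_commutator_fermionEmbed`; `N̂` is translation invariant), so
`|Re⟨ζ,(N̂W_L − W_LN̂)ζ⟩| ≤ (Σ_{s,t}|(N̂₀w − wN̂₀)_{st}|)·L²` for every unit `ζ` — for a multiplier-weighted sum of
charge-`q_i` words this constant is `≤ Σ_i |q_i|·Σ|w_{i,st}|`. [cite: BratteliRobinsonII1997, §6.2.1] -/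
theorem abs_re_expect_totalNumber_commutator_translationSum_le (h : Set.InjOn (Torus.proj (d := 2) L) ↑Λb)
    (wloc : FermionOp Λb) (ζ : Fock (Orb (FermionTorus 2 L))) (hζ : star ζ ⬝ᵥ ζ = 1) :
    |(star ζ ⬝ᵥ ((totalNumber *
        (∑ v : TorusSite 2 L, relabel (Orb.translate v) (fermionEmbed (PolySite.toTorusEmb L h) wloc)) -
      (∑ v : TorusSite 2 L, relabel (Orb.translate v) (fermionEmbed (PolySite.toTorusEmb L h) wloc)) *
        totalNumber) *ᵥ ζ)).re| ≤
      (∑ s, ∑ t, ‖(totalNumberOp * wloc - wloc * totalNumberOp : FermionOp Λb) s t‖) * (L : ℝ) ^ 2 := by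
  set cw : FermionOp Λb := (totalNumberOp : FermionOp Λb) * wloc - wloc * totalNumberOp with hcw
  -- the commutator is the translation sum of the local word `cw`
  have hloc : (totalNumber : Matrix (Finset (Orb (FermionTorus 2 L))) (Finset (Orb (FermionTorus 2 L))) ℂ) *
      fermionEmbed (PolySite.toTorusEmb L h) wloc - fermionEmbed (PolySite.toTorusEmb L h) wloc * totalNumber =
      fermionEmbed (PolySite.toTorusEmb L h) cw := by
    rw [← totalNumberOp_eq_totalNumber, totalNumberOp_commutator_fermionEmbed]
  have hT : ∀ v : TorusSite 2 L, relabel (Orb.translate v)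
      (totalNumber : Matrix (Finset (Orb (FermionTorus 2 L))) (Finset (Orb (FermionTorus 2 L))) ℂ) = totalNumber :=
    fun v => by rw [Orb.translate, relabel_mapEquiv_totalNumber]
  have hsum : totalNumber *
        (∑ v : TorusSite 2 L, relabel (Orb.translate v) (fermionEmbed (PolySite.toTorusEmb L h) wloc)) -
      (∑ v : TorusSite 2 L, relabel (Orb.translate v) (fermionEmbed (PolySite.toTorusEmb L h) wloc)) * totalNumber =
      ∑ v : TorusSite 2 L, relabel (Orb.translate v) (fermionEmbed (PolySite.toTorusEmb L h) cw) := by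
    rw [Finset.mul_sum, Finset.sum_mul, ← Finset.sum_sub_distrib]
    refine Finset.sum_congr rfl fun v _ => ?_
    rw [← hT v, ← relabel_mul, ← relabel_mul, ← relabel_sub, hloc]
  have hexp : star ζ ⬝ᵥ ((∑ v : TorusSite 2 L, relabel (Orb.translate v)
      (fermionEmbed (PolySite.toTorusEmb L h) cw)) *ᵥ ζ) = ((L : ℂ) ^ 2) * torusAvgExpectAt L Λb cw ζ :=
    expect_sum_relabel_translate_fermionEmbed' L h cw ζ
  rw [hsum, hexp]
  have hnorm : ‖torusAvgExpectAt L Λb cw ζ‖ ≤ ∑ s, ∑ t, ‖cw s t‖ := norm_torusAvgExpectAt_le_sum_norm L Λb cw hζ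
  calc |(((L : ℂ) ^ 2) * torusAvgExpectAt L Λb cw ζ).re|
      ≤ ‖((L : ℂ) ^ 2) * torusAvgExpectAt L Λb cw ζ‖ := Complex.abs_re_le_norm _
    _ = (L : ℝ) ^ 2 * ‖torusAvgExpectAt L Λb cw ζ‖ := by rw [norm_mul, norm_pow, Complex.norm_natCast]
    _ ≤ (L : ℝ) ^ 2 * ∑ s, ∑ t, ‖cw s t‖ := mul_le_mul_of_nonneg_left hnorm (by positivity)
    _ = (∑ s, ∑ t, ‖cw s t‖) * (L : ℝ) ^ 2 := mul_comm _ _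

end ChargeOnePoint

end Summit.Ventures.CertifiedManyBodySolver.Observables

end
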